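import Summits.HodgeConjecture.CorCM.Census.HalfParityCount

/-!
# Fibre-independence criteria: block parities and stabiliser half-parities detect the coinvariant fibre EXACTLY

COR-CM (cell `pub-hodgecm2`), count-neutral kernel combinatorics by the binder seat b09 (gen 38; lane TWO-ADIC SPLITTING +
NONDEGENERATE REDUCTION, part G), on top of seat b09ʼs half-parity series (`Census/HalfParityCharacters.lean`: the character functionals
`theta c χ : [Ψ] ↦ χ(trp Ψ)`; `Census/HalfParityCount.lean`: the stabiliser characters `charK c = 𝔛(G,c)`, `rad2_le_ker_pi_theta`,
`inf_ker_par2_prod_pi_theta_le_rad2`) and `Census/CoinvariantFloor.lean` (`par2`, `par2_red`, `rad2_le_ker_par2`) used BY NAME.  Theorems only: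
no definition, no `decide`, no certificate, no named fact, no `sorry`.
HONEST FRAMING: `HC_CM` is NOT proved, here or anywhere in the tree; nothing here is a period or a headline.

WHY.  Part B of this lane (`Census/TwoAdicSplitting.lean`) makes `μ(G,c) = φ₂(G,c)` for a `2`-group follow from a FIBRE-INDEPENDENT face family
generating after inverting `2`; part B gave the sufficient criterion «block parities independent».  That criterion is blind to
`t(G,c) = dim 𝔛(G,c) − …` fibre directions (`Census/HalfParityLaw.lean`: `φ₂ + 1 + δ = β + t`): e.g. for the generalised quaternion groups
(`d₂ = 2`) a generating family needs `β` faces but the parities see only `β − 2` of them.  THIS FILE gives the EXACT criterion: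

* §1 `thetaIndep ⟹ fibreIndep` (`fibreIndep_of_thetaIndep`): if the vectors `Θ(f) = (par f, (θ_χ(red f))_{χ ∈ 𝔛(G,c)})` of a family `S` are
  linearly independent over `𝔽₂`, the family is fibre-independent (both `par2` and every `θ_χ`, `χ ∈ 𝔛`, kill `rad2`).
* §2 `fibreIndep ⟹ thetaIndep` for families of Hodge vectors (`thetaIndep_of_fibreIndep`): `(par2, (θ_χ)_χ)` is INJECTIVE on the fibre
  (`HalfParity.inf_ker_par2_prod_pi_theta_le_rad2`), so the criterion loses nothing (`thetaIndep_iff_fibreIndep`).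
For a face two of whose corners `Ψ`, `Ψ·Q⁻¹` share a block, their joint contribution to `θ_χ` is `χ(Q)` — choice-free; this is how a closing face
at the base type earns the missing fibre direction of a `d₂ ≥ 1` group.

## References
* [Pohlmann1968] H. Pohlmann, Algebraic cycles on abelian varieties of complex multiplication type, Ann. of Math. 88 (1968), Thm 1.
-/

namespace Summit.HodgeConjecture.CorCM.Census.Splitting

open Finset
open Summit.HodgeConjecture.CorCM.Prior.AllgGroup.RfwfAllgGroup
open Summit.HodgeConjecture.CorCM.Census.BlockParity
open Summit.HodgeConjecture.CorCM.Census.Coinvariant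
open Summit.HodgeConjecture.CorCM.Census.HalfParity

noncomputable section

variable {G : Type*} [Group G] [Fintype G] [DecidableEq G] (c : G)

/-! ## §1 Parities and stabiliser half-parities independent ⟹ fibre-independent -/

/-- The joint functional `(par2, (θ_χ)_{χ ∈ 𝔛})` kills `rad2` (central `c`). [folklore] -/
theorem rad2_le_ker_par2_prod_pi_theta (hc2 : c * c = 1) (hcen : ∀ x : G, x * c = c * x) :
    rad2 c hc2 ≤ LinearMap.ker ((par2 c).prod (LinearMap.pi fun χ : ↥(charK c) => theta c χ.1)) := by
  intro x hx
  rw [LinearMap.mem_ker, LinearMap.prod_apply, Prod.mk_eq_zero]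
  exact ⟨LinearMap.mem_ker.mp (rad2_le_ker_par2 c hc2 hx), LinearMap.mem_ker.mp (rad2_le_ker_pi_theta c hc2 hcen hx)⟩

/-- **Theta-independent ⟹ fibre-independent**: if the vectors `(par f, (θ_χ (red f))_{χ ∈ 𝔛(G,c)})`, `f ∈ S`, are linearly independent over
`𝔽₂`, then the fibre images of `S` are linearly independent. [folklore] -/
theorem fibreIndep_of_thetaIndep (hc2 : c * c = 1) (hcen : ∀ x : G, x * c = c * x) (s : Set (CMF G c →₀ ℤ))
    (h : LinearIndepOn (ZMod 2)
      (fun f : CMF G c →₀ ℤ => (par c f, fun χ : ↥(charK c) => theta c χ.1 (red c f))) s) :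
    LinearIndepOn (ZMod 2) (fun f : CMF G c →₀ ℤ => (rad2 c hc2).mkQ (red c f)) s := by
  set Θ : (CMF G c →₀ ZMod 2) →ₗ[ZMod 2] (Block c → ZMod 2) × (↥(charK c) → ZMod 2) :=
    (par2 c).prod (LinearMap.pi fun χ : ↥(charK c) => theta c χ.1) with hΘ
  set Θbar : ((CMF G c →₀ ZMod 2) ⧸ rad2 c hc2) →ₗ[ZMod 2] (Block c → ZMod 2) × (↥(charK c) → ZMod 2) :=
    (rad2 c hc2).liftQ Θ (rad2_le_ker_par2_prod_pi_theta c hc2 hcen) with hΘbar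
  have e : (fun f : CMF G c →₀ ℤ => (par c f, fun χ : ↥(charK c) => theta c χ.1 (red c f))) =
      Θbar ∘ (fun f : CMF G c →₀ ℤ => (rad2 c hc2).mkQ (red c f)) := by
    funext f
    simp only [Function.comp_apply]
    rw [hΘbar, Submodule.mkQ_apply, Submodule.liftQ_apply, hΘ]
    change _ = (par2 c (red c f), (LinearMap.pi fun χ : ↥(charK c) => theta c χ.1) (red c f))
    rw [par2_red]
    rfl
  rw [e] at h
  exact LinearIndepOn.of_comp Θbar h

/-! ## §2 The criterion is exact on Hodge vectors -/

/-- **`(par2, (θ_χ)_χ)` is injective on the fibre**: a class of the fibre (the image of a Hodge vector mod `2`) killed by all block parities and all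
stabiliser half-parities is zero. [folklore] -/
theorem liftQ_injOn_fibre (hc2 : c * c = 1) (hc1 : c ≠ 1) (hcen : ∀ x : G, x * c = c * x)
    {z : (CMF G c →₀ ZMod 2) ⧸ rad2 c hc2} (hz : z ∈ fibre c hc2)
    (h0 : (rad2 c hc2).liftQ ((par2 c).prod (LinearMap.pi fun χ : ↥(charK c) => theta c χ.1))
      (rad2_le_ker_par2_prod_pi_theta c hc2 hcen) z = 0) : z = 0 := by
  obtain ⟨x, hx, rfl⟩ := Submodule.mem_map.mp hz
  rw [Submodule.mkQ_apply, Submodule.liftQ_apply] at h0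
  have hxr : x ∈ rad2 c hc2 := inf_ker_par2_prod_pi_theta_le_rad2 c hc2 hc1 hcen ⟨hx, LinearMap.mem_ker.mpr h0⟩
  rw [Submodule.mkQ_apply, Submodule.Quotient.mk_eq_zero]
  exact hxr

/-- **Fibre-independent ⟹ theta-independent** for families of integer Hodge vectors. [folklore] -/
theorem thetaIndep_of_fibreIndep (hc2 : c * c = 1) (hc1 : c ≠ 1) (hcen : ∀ x : G, x * c = c * x) (s : Set (CMF G c →₀ ℤ))
    (hs : s ⊆ hodgeSpan c hc2)
    (h : LinearIndepOn (ZMod 2) (fun f : CMF G c →₀ ℤ => (rad2 c hc2).mkQ (red c f)) s) :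
    LinearIndepOn (ZMod 2) (fun f : CMF G c →₀ ℤ => (par c f, fun χ : ↥(charK c) => theta c χ.1 (red c f))) s := by
  set Θ : (CMF G c →₀ ZMod 2) →ₗ[ZMod 2] (Block c → ZMod 2) × (↥(charK c) → ZMod 2) :=
    (par2 c).prod (LinearMap.pi fun χ : ↥(charK c) => theta c χ.1) with hΘ
  set Θbar : ((CMF G c →₀ ZMod 2) ⧸ rad2 c hc2) →ₗ[ZMod 2] (Block c → ZMod 2) × (↥(charK c) → ZMod 2) :=
    (rad2 c hc2).liftQ Θ (rad2_le_ker_par2_prod_pi_theta c hc2 hcen) with hΘbar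
  have e : (fun f : CMF G c →₀ ℤ => (par c f, fun χ : ↥(charK c) => theta c χ.1 (red c f))) =
      Θbar ∘ (fun f : CMF G c →₀ ℤ => (rad2 c hc2).mkQ (red c f)) := by
    funext f
    simp only [Function.comp_apply]
    rw [hΘbar, Submodule.mkQ_apply, Submodule.liftQ_apply, hΘ]
    change _ = (par2 c (red c f), (LinearMap.pi fun χ : ↥(charK c) => theta c χ.1) (red c f))
    rw [par2_red]
    rfl
  rw [e]
  -- `Θbar` is injective on the span of the fibre images of `s` (contained in the fibre)
  refine LinearIndepOn.map_injOn h Θbar (Set.InjOn.mono (s₂ := ↑(fibre c hc2)) ?_ ?_)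
  · rw [SetLike.coe_subset_coe, Submodule.span_le, Set.image_subset_iff]
    intro f hf
    exact mkQ_mem_fibre c hc2 (red_mem_hodge2 c hc2 (hs hf))
  · intro z₁ hz₁ z₂ hz₂ heq
    have hsub : z₁ - z₂ ∈ fibre c hc2 := Submodule.sub_mem _ hz₁ hz₂
    have h0 : Θbar (z₁ - z₂) = 0 := by rw [map_sub, sub_eq_zero]; exact heq
    exact sub_eq_zero.mp (liftQ_injOn_fibre c hc2 hc1 hcen hsub h0)

/-- **THE EXACT CRITERION**: for a family of integer Hodge vectors, fibre-independence ⟺ independence of the vectors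
`(par f, (θ_χ (red f))_{χ ∈ 𝔛(G,c)})`. [folklore] -/
theorem thetaIndep_iff_fibreIndep (hc2 : c * c = 1) (hc1 : c ≠ 1) (hcen : ∀ x : G, x * c = c * x) (s : Set (CMF G c →₀ ℤ))
    (hs : s ⊆ hodgeSpan c hc2) :
    LinearIndepOn (ZMod 2) (fun f : CMF G c →₀ ℤ => (par c f, fun χ : ↥(charK c) => theta c χ.1 (red c f))) s ↔
      LinearIndepOn (ZMod 2) (fun f : CMF G c →₀ ℤ => (rad2 c hc2).mkQ (red c f)) s :=
  ⟨fibreIndep_of_thetaIndep c hc2 hcen s, thetaIndep_of_fibreIndep c hc2 hc1 hcen s hs⟩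

end

end Summit.HodgeConjecture.CorCM.Census.Splitting
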